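import Summits.Ventures.PercRepro.C041TriDomExcessConvNonSep

/-!
# ROW C-041 — THE EQUALITY CASE OF THE EXCESS, XI: THE CONVERSE AND THEOREM (EQUALITY CASE)
(p6, gen 44; P6-TWOEXIT-LEAN.md §53 ADDENDUM 11, part III of III)

**THEOREM (CONNECTED AND NON-SEPARABLE ⟹ `e ≥ 1`)** (`excess_ge_one_of_not_separable`): if the three marks of a
finite host are connected and no mark separates the other two (`¬ SeparableS` of the all-free status), then
`N_RRa ≥ N_RB + N_WRj + N_RWj + 1`.  With THEOREM (SEPARABLE ⟹ THE EXCESS VANISHES) this is **THEOREM (EQUALITY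
CASE)** (`excess_eq_zero_iff_separable`): the excess of a three-marked host is zero exactly when the host is
separable — the marks not all connected, or one of them a cut vertex between the other two.

PROOF — a contraction-only minor induction on the number of free edges of a non-separable status
(`excess_ge_one_of_nonSep`): a free edge with both ends off the mark classes contracts (`NonSep.contract_off`);
a star or a triangle of free edges between the classes IS a star / triangle minor once the other free edges are
deleted (`keepThree`: the double-classes are unchanged, `excess_ge_one_of_star`, `excess_ge_one_of_tri` on the
theorems of `C041TriDomExcessMinorMain`); otherwise every free edge touches a mark class and some pair of mark
classes is not joined by a free edge, and THE REDUCTION LEMMA (`NonSep.reduce`, in the orientation of the missing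
pair) gives a star or a contraction.  The all-free status has singleton classes, so `¬ SeparableS` is
`NonSep` there (`nonSep_free_of_not_separable`).
-/

namespace PercRepro

namespace ZoneZ

namespace MultiExit

open ZoneData Finset

variable {V₁ E₁ U₁ U₂ : Type} (Z₁ : ZoneData V₁ E₁ U₁ U₂) (u u' a₁ : V₁)

variable [DecidableEq E₁]

/-! ## Keeping three free edges -/

/-- The status with every free edge other than `f₁, f₂, f₃` deleted. -/
def keepThree (st : E₁ → EStat) (f₁ f₂ f₃ : E₁) : E₁ → EStat := fun e =>
  if st e = .free ∧ e ≠ f₁ ∧ e ≠ f₂ ∧ e ≠ f₃ then .absent else st e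

/-- `keepThree` keeps the double edges. -/
theorem dblE_keepThree (st : E₁ → EStat) (f₁ f₂ f₃ : E₁) (e : E₁) :
    dblE (keepThree st f₁ f₂ f₃) e ↔ dblE st e := by
  unfold dblE keepThree
  by_cases h : st e = .free ∧ e ≠ f₁ ∧ e ≠ f₂ ∧ e ≠ f₃
  · rw [if_pos h, h.1]
    exact ⟨fun h' => EStat.noConfusion h', fun h' => EStat.noConfusion h'⟩
  · rw [if_neg h]

/-- `keepThree` keeps the double-classes. -/
theorem DConn_keepThree (st : E₁ → EStat) (f₁ f₂ f₃ : E₁) :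
    DConn Z₁ (keepThree st f₁ f₂ f₃) = DConn Z₁ st :=
  DConn_congr Z₁ (dblE_keepThree st f₁ f₂ f₃)

/-- `keepThree` of three free edges is three-free. -/
theorem threeFree_keepThree {st : E₁ → EStat} {f₁ f₂ f₃ : E₁} (h1 : st f₁ = .free) (h2 : st f₂ = .free)
    (h3 : st f₃ = .free) : ThreeFree (keepThree st f₁ f₂ f₃) f₁ f₂ f₃ := by
  refine ⟨?_, ?_, ?_, fun e he1 he2 he3 => ?_⟩
  · unfold keepThree
    rw [if_neg (fun h => h.2.1 rfl)]
    exact h1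
  · unfold keepThree
    rw [if_neg (fun h => h.2.2.1 rfl)]
    exact h2
  · unfold keepThree
    rw [if_neg (fun h => h.2.2.2 rfl)]
    exact h3
  · unfold keepThree
    by_cases hf : st e = .free
    · rw [if_pos ⟨hf, he1, he2, he3⟩]
      exact fun h => EStat.noConfusion h
    · rw [if_neg (fun h => hf h.1)]
      exact hf

variable [Fintype E₁]

/-- A star of free edges between the classes of a non-separable status forces `e ≥ 1`. -/
theorem excess_ge_one_of_star {st : E₁ → EStat} (h : NonSep Z₁ st a₁ u u') (hs : Star Z₁ st a₁ u u') :
    1 ≤ excess Z₁ u u' a₁ := by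
  obtain ⟨w, hw, ⟨f₁, hf1, p₁, q₁, hj1, hw1, ha1⟩, ⟨f₂, hf2, p₂, q₂, hj2, hw2, hu2⟩,
    ⟨f₃, hf3, p₃, q₃, hj3, hw3, hu3⟩⟩ := hs
  have hD := DConn_keepThree Z₁ st f₁ f₂ f₃
  refine excess_ge_one_of_starMinor Z₁ u u' a₁ (st := keepThree st f₁ f₂ f₃) (c := w) (f₁ := f₁) (f₂ := f₂)
    (f₃ := f₃) ?_
  refine ⟨threeFree_keepThree hf1 hf2 hf3, ?_, ?_, ?_, ?_, ?_, ?_, ?_, ?_, ?_⟩ <;> rw [hD]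
  · exact fun h' => hw.1 (DConn_symm Z₁ h')
  · exact fun h' => hw.2.1 (DConn_symm Z₁ h')
  · exact fun h' => hw.2.2 (DConn_symm Z₁ h')
  · exact h.nxy
  · exact h.nxz
  · exact h.nyz
  · exact ⟨p₁, q₁, hj1, hw1, ha1⟩
  · exact ⟨p₂, q₂, hj2, hw2, hu2⟩
  · exact ⟨p₃, q₃, hj3, hw3, hu3⟩

/-- A triangle of free edges between the classes of a non-separable status forces `e ≥ 1`. -/
theorem excess_ge_one_of_tri {st : E₁ → EStat} (h : NonSep Z₁ st a₁ u u') (ht : Tri Z₁ st a₁ u u') :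
    1 ≤ excess Z₁ u u' a₁ := by
  obtain ⟨⟨f₁, hf1, p₁, q₁, hj1, ha1, hu1⟩, ⟨f₂, hf2, p₂, q₂, hj2, ha2, hu2⟩,
    ⟨f₃, hf3, p₃, q₃, hj3, hu3, hu3'⟩⟩ := ht
  have hD := DConn_keepThree Z₁ st f₁ f₂ f₃
  refine excess_ge_one_of_triMinor Z₁ u u' a₁ (st := keepThree st f₁ f₂ f₃) (f₁ := f₁) (f₂ := f₂) (f₃ := f₃) ?_
  refine ⟨threeFree_keepThree hf1 hf2 hf3, ?_, ?_, ?_, ?_, ?_, ?_⟩ <;> rw [hD]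
  · exact h.nxy
  · exact h.nxz
  · exact h.nyz
  · exact ⟨p₁, q₁, hj1, ha1, hu1⟩
  · exact ⟨p₂, q₂, hj2, ha2, hu2⟩
  · exact ⟨p₃, q₃, hj3, hu3, hu3'⟩

/-! ## The induction -/

/-- **THE CONVERSE, STATUS FORM**: a non-separable status forces `e ≥ 1` — contraction-only minor induction on the
number of free edges. -/
theorem excess_ge_one_of_nonSep (n : ℕ) :
    ∀ st : E₁ → EStat, nfree st = n → NonSep Z₁ st a₁ u u' → 1 ≤ excess Z₁ u u' a₁ := by
  induction n using Nat.strong_induction_on with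
  | _ n ih =>
  intro st hn h
  have hstep : ∀ f, st f = .free → NonSep Z₁ (Function.update st f .double) a₁ u u' →
      1 ≤ excess Z₁ u u' a₁ := by
    intro f hf h'
    have hlt : nfree (Function.update st f .double) < n := by
      have := nfree_update hf (s := .double) (by decide)
      omega
    exact ih _ hlt _ rfl h'
  by_cases hoff : ∃ f, st f = .free ∧ ∃ p q, Z₁.Joins f p q ∧ OffMarks Z₁ st a₁ u u' p ∧ OffMarks Z₁ st a₁ u u' q
  · obtain ⟨f, hf, p, q, hj, hp, hq⟩ := hoff
    exact hstep f hf (NonSep.contract_off Z₁ h hf hj hp hq)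
  have hT : Touching Z₁ st a₁ u u' := by
    intro f hf p q hj
    by_contra hc
    push Not at hc
    exact hoff ⟨f, hf, p, q, hj, hc.1, hc.2⟩
  by_cases hstar : Star Z₁ st a₁ u u'
  · exact excess_ge_one_of_star Z₁ u u' a₁ h hstar
  by_cases htri : Tri Z₁ st a₁ u u'
  · exact excess_ge_one_of_tri Z₁ u u' a₁ h htri
  by_cases h1 : ∃ f, FreeJoin Z₁ st f a₁ u
  · by_cases h2 : ∃ f, FreeJoin Z₁ st f a₁ u'
    · have h3 : ¬ ∃ f, FreeJoin Z₁ st f u u' := fun h3 => htri ⟨h1, h2, h3⟩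
      rcases NonSep.reduce Z₁ h.swap12 hT.swap12 h3 with hs | ⟨f, hf, h'⟩
      · exact absurd hs.swap12 hstar
      · exact hstep f hf h'.swap12
    · rcases NonSep.reduce Z₁ h hT h2 with hs | ⟨f, hf, h'⟩
      · exact absurd hs hstar
      · exact hstep f hf h'
  · rcases NonSep.reduce Z₁ h.swap23 hT.swap23 h1 with hs | ⟨f, hf, h'⟩
    · exact absurd hs.swap23 hstar
    · exact hstep f hf h'.swap23

/-! ## The host theorem -/

omit [DecidableEq E₁] [Fintype E₁] in
/-- With every edge free, avoiding the class of `a` is avoiding `a`: the side of `a` seen from `c`. -/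
theorem PConnA_free_iff_side (a b c : V₁) :
    PConnA Z₁ (fun _ => EStat.free) (cls Z₁ (fun _ => EStat.free) a) c b ↔ b ∈ side Z₁ (fun _ => EStat.free) a c := by
  have hR : PAvoid Z₁ (fun _ => EStat.free) (cls Z₁ (fun _ => EStat.free) a) = PAdjAvoid Z₁ (fun _ => EStat.free) a := by
    funext x y
    unfold PAvoid PAdjAvoid
    have hx : x ∉ cls Z₁ (fun _ => EStat.free) a ↔ x ≠ a := by
      rw [mem_cls, DConn_iff_eq_of_no_dbl Z₁ (fun _ h => EStat.noConfusion h)]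
      exact ne_comm
    have hy : y ∉ cls Z₁ (fun _ => EStat.free) a ↔ y ≠ a := by
      rw [mem_cls, DConn_iff_eq_of_no_dbl Z₁ (fun _ h => EStat.noConfusion h)]
      exact ne_comm
    rw [hx, hy]
  unfold PConnA side
  rw [hR, mem_reach_singleton]

omit [DecidableEq E₁] [Fintype E₁] in
/-- A host that is not separable is a non-separable all-free status. -/
theorem nonSep_free_of_not_separable (h : ¬ SeparableS Z₁ u u' a₁ (fun _ => EStat.free)) :
    NonSep Z₁ (fun _ => EStat.free) a₁ u u' := by
  unfold SeparableS SepS at h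
  push Not at h
  obtain ⟨_, ⟨hua, hu'a, hside1⟩, ⟨hau, hu'u, hside2⟩, ⟨hau', huu', hside3⟩⟩ := h
  have hD := DConn_iff_eq_of_no_dbl Z₁ (st := fun _ => EStat.free) (fun _ h => EStat.noConfusion h)
  refine ⟨?_, ?_, ?_, ?_, ?_, ?_⟩
  · rw [hD]; exact fun h' => hua h'.symm
  · rw [hD]; exact fun h' => hu'a h'.symm
  · rw [hD]; exact fun h' => hu'u h'.symm
  · exact PConnA_symm Z₁ ((PConnA_free_iff_side Z₁ a₁ u u').2 hside1)
  · exact PConnA_symm Z₁ ((PConnA_free_iff_side Z₁ u a₁ u').2 hside2)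
  · exact PConnA_symm Z₁ ((PConnA_free_iff_side Z₁ u' a₁ u).2 hside3)

/-- **THEOREM (CONNECTED AND NON-SEPARABLE ⟹ `e ≥ 1`)**: if the three marks are connected and no mark separates
the other two, `N_RRa ≥ N_RB + N_WRj + N_RWj + 1`. -/
theorem excess_ge_one_of_not_separable (h : ¬ SeparableS Z₁ u u' a₁ (fun _ => EStat.free)) :
    1 ≤ excess Z₁ u u' a₁ :=
  excess_ge_one_of_nonSep Z₁ u u' a₁ _ _ rfl (nonSep_free_of_not_separable Z₁ u u' a₁ h)

/-- **THEOREM (EQUALITY CASE)**: the excess of a three-marked host vanishes exactly when the host is separable —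
the marks not all connected, or one of them a cut vertex between the other two (coincidences included). -/
theorem excess_eq_zero_iff_separable :
    excess Z₁ u u' a₁ = 0 ↔ SeparableS Z₁ u u' a₁ (fun _ => EStat.free) := by
  constructor
  · intro h0
    by_contra hns
    have := excess_ge_one_of_not_separable Z₁ u u' a₁ hns
    linarith
  · exact excess_eq_zero_of_separable Z₁ u u' a₁

/-- **THEOREM (EQUALITY CASE), positive form**: the excess is positive exactly on the non-separable hosts. -/
theorem excess_pos_iff_not_separable :
    0 < excess Z₁ u u' a₁ ↔ ¬ SeparableS Z₁ u u' a₁ (fun _ => EStat.free) := by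
  rw [← excess_eq_zero_iff_separable Z₁ u u' a₁]
  have := excess_nonneg Z₁ u u' a₁
  constructor
  · intro h h0
    rw [h0] at h
    exact lt_irrefl _ h
  · intro h
    exact lt_of_le_of_ne this (Ne.symm h)

/-- **THEOREM (EQUALITY CASE), integer form**: `e ≥ 1` on every non-separable host, `e = 0` on every separable one. -/
theorem excess_ge_one_iff_not_separable :
    1 ≤ excess Z₁ u u' a₁ ↔ ¬ SeparableS Z₁ u u' a₁ (fun _ => EStat.free) := by
  constructor
  · intro h hs
    have := excess_eq_zero_of_separable Z₁ u u' a₁ hs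
    linarith
  · exact excess_ge_one_of_not_separable Z₁ u u' a₁

end MultiExit

end ZoneZ

end PercRepro
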